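import Mathlib
import HarnessLib
import Summits.NavierStokesRegularity.NavierStokesRegularity.Theorems.PoloidalWindowDoorLrcModEntireTwistingTHPlaneOscillation
import Summits.NavierStokesRegularity.NavierStokesRegularity.Theorems.PoloidalWindowDoorLrcModEntireTwistingTHHotPointPins
import Summits.NavierStokesRegularity.NavierStokesRegularity.Theorems.PoloidalWindowDoorLrcModEntireTwistingTHHotSpotSlope

/-!
# Item `LrcModEntire` (stmt-NavierStokesRegularity-20428), registry twist_split v7 — THE RIDGE LAW OF THE (TH) COLUMN (memo `Cruxes/LrcModEntire/T2B-g14.md` §3 (R-c)):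
# on a (TH) thread plane, `Δv₂(−1,·)`, `Δₕv₂(−1,·)` and the vertical pressure gradient take ONE value on the whole hot set

LEAD of item 20428 ns-poloidal-K2-p3 g14 (`--supports stmt-NavierStokesRegularity-20428 --as helper`).  For a class profile, poloidal, with the hot-spot normalisation
`√(−t)|v₂| ≤ |v₂(−1,0)| = |N|`, carrying the (TH) structure near the thread plane `P₀ = {y₂ = 0}` of the slice `−1` with a slope function `μ(s,y₂)` (`uncurry μ ∈ C³`, the
currency of `…TwistingTHPlaneOscillation`): at any two HOT points `y, y′ ∈ P₀` (`v₂(−1,y) = v₂(−1,y′) = N`)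

* `laplacian_two_eq_of_hotPoints` — **`Δv₂(−1,·)(y) = Δv₂(−1,·)(y′)`** provided `μ(−1,0) ≠ 1`: evaluate the plane-constant doubled source of
  `…TwistingTHPlaneOscillation.weightSource_eq_of_height_eq` (`2(1−μ)f₂ − 2(μ_t−μ_zz)v₂ − μ_zv₂² + 4μ_z∂₂v₂`, `f = ∂ₜv + (v·∇)v − Δv`) at the two points with the hot-point pins
  of `…TwistingTHHotPointPins` (`∂ₜv₂ = N/2`, `∇v₂ = 0`);
* `horizLaplacian_two_eq_of_hotPoints` — the same for the horizontal Laplacian `∂₀²v₂ + ∂₁²v₂` (plane wave identity `∂₂²v₂ = −μΔₕv₂` on the (TH) plane,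
  `…TimeHeightShearLinearSlice.plane_wave_identity`): the transversal curvature `κ` of the hot ridge is CONSTANT along it;
* `gradient_pressure_two_eq_of_hotPoints` — for every classical pressure `P`: `(∇P(−1,·))(y)₂ = (∇P(−1,·))(y′)₂` (`= Δv₂ − N/2`, `…HotPointPins.gradient_pressure_two_of_hotPoint`):
  the pressure pushes down with ONE strength along the whole web.

These make `…RidgeSecondOrder.quasiconvexOn_sq_of_ridgeLaw` applicable in the (TH) column (`κ`, `β = θ_zz = μ₀κ` constant along `H` ⇒ `|∇ₕ∂_z v₂|²` quasiconvex along every hot branch).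
WHAT THIS IS NOT: not a claim about Navier–Stokes regularity — structure of the hypothetical ridge of `stub_T2b` (bears_on LADDER-NS N0, item 20428 / crux 19708; both OPEN, ⟨27893⟩ OPEN).
-/

noncomputable section

-- the summit and its single sub-problem share the name (CONVENTIONS §1), as in every Theorems file
set_option linter.dupNamespace false

namespace Summit.NavierStokesRegularity.NavierStokesRegularity.Theorems.PoloidalWindowDoorLrcModEntireTwistingTHRidgeLaw

open MeasureTheory Set Function Filter Topology
open scoped RealInnerProductSpace InnerProductSpace Laplacian ContDiff
open Literature.Analysis Literature.Analysis.FluidPDE Literature.Analysis.UnboundedOperators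
open Summit.NavierStokesRegularity.NavierStokesRegularity.Theorems
open Summit.NavierStokesRegularity.NavierStokesRegularity.Theorems.PoloidalWindowDoorLrcModEntireTwistingTHPlaneOscillation
open Summit.NavierStokesRegularity.NavierStokesRegularity.Theorems.PoloidalWindowDoorLrcModEntireTwistingTHHotPointPins
open Summit.NavierStokesRegularity.NavierStokesRegularity.Theorems.PoloidalWindowDoorPoloidalWindowRigidityWindow
open Summit.NavierStokesRegularity.NavierStokesRegularity.Theorems.PoloidalWindowDoorLrcModEntireThreadPressure
open Summit.NavierStokesRegularity.NavierStokesRegularity.Theorems.PoloidalWindowDoorPoloidalWindowRigidityTimeHeightShearLinearSlice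
open Summit.NavierStokesRegularity.NavierStokesRegularity.Theorems.PoloidalWindowDoorPoloidalWindowRigidityConstantShearSlice
open Summit.NavierStokesRegularity.NavierStokesRegularity.Theorems.PoloidalWindowDoorPoloidalWindowRigidityLocalFrozenLaw
open Summit.NavierStokesRegularity.NavierStokesRegularity.Theorems.PoloidalWindowDoorPoloidalWindowRigidityClebsch
open Summit.NavierStokesRegularity.NavierStokesRegularity.Theorems.PoloidalWindowDoorPoloidalWindowRigiditySlopeFunctionPressure

variable {C : ℝ} {v : ℝ → EuclideanSpace ℝ (Fin 3) → EuclideanSpace ℝ (Fin 3)}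

/-- The vertical component of the intrinsic residual `f = ∂ₜv + (v·∇)v − Δv` at a hot point: `f₂(−1,y) = N/2 − Δ(v₂(−1,·))(y)`. -/
theorem residual_two_of_hotPoint (hrate : HasTypeITimeDecay C v)
    (hcont : ContinuousOn (uncurry v) (Iio (0 : ℝ) ×ˢ univ))
    (hmild : ∀ s t : ℝ, s < t → t < 0 → ∀ x, v t x = heatExtension (v s) (t - s) x - oseenDuhamel 1 s v v t x)
    (hdiv : ∀ t < 0, VectorCalculus.IsDivFree (v t))
    (hne : v (-1) 0 2 ≠ 0) (hhot : ∀ t < 0, ∀ x, Real.sqrt (-t) * |v t x 2| ≤ |v (-1) 0 2|)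
    {y : EuclideanSpace ℝ (Fin 3)} (hy : v (-1) y 2 = v (-1) 0 2) :
    (timeDerivWithin (Iio 0) v (-1) y + convect (v (-1)) (v (-1)) y - Δ (v (-1)) y) 2 =
      v (-1) 0 2 / 2 - (Δ (fun w => v (-1) w 2)) y := by
  have hs : (-1 : ℝ) < 0 := by norm_num
  have hsm : IsSmoothSpaceTimeOn (Iio 0) v := (isTypeIAncientMild_of_class hrate hcont hmild hdiv).contDiffOn
  have htd : timeDerivWithin (Iio 0) v (-1) y = deriv (fun s => v s y) (-1) := by
    rw [timeDerivWithin_apply, derivWithin_of_mem_nhds (Iio_mem_nhds hs)]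
  have hct : ContDiffAt ℝ ∞ (uncurry v) ((-1 : ℝ), y) := hsm.contDiffAt isOpen_Iio (mem_Iio.2 hs) y
  have hd : DifferentiableAt ℝ (uncurry v) ((-1 : ℝ), y) := hct.differentiableAt (by simp)
  have hl : DifferentiableAt ℝ (fun s : ℝ => ((s, y) : ℝ × EuclideanSpace ℝ (Fin 3))) (-1) :=
    differentiableAt_id.prodMk (differentiableAt_const _)
  have hline : DifferentiableAt ℝ (fun s => v s y) (-1) := by
    have h := hd.comp (-1) hl
    exact h
  have hslice : ContDiff ℝ ∞ (v (-1)) := IsSmoothSpaceTimeOn.contDiff_slice (S := Iio 0) (w := v) hsm hs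
  have hslice2 : ContDiffAt ℝ 2 (v (-1)) y := (hslice.of_le (by norm_cast)).contDiffAt
  rw [htd, convect_apply]
  simp only [PiLp.add_apply, PiLp.sub_apply]
  rw [deriv_apply_coord hline 2, timePin_of_hotPoint hrate hcont hmild hdiv hne hhot hy,
    gradPin_of_hotPoint hrate hcont hmild hdiv hhot hy (v (-1) y), laplacian_apply_coord hslice2 2]
  ring

/-- **THE RIDGE LAW, vertical Laplacian.**  Class profile, poloidal, hot-spot normalised, (TH) near the thread plane of the slice `−1` with a `C³` slope function `μ`,
`μ(−1,0) ≠ 1`: at any two hot points `y, y′` of `P₀`, `Δ(v₂(−1,·))(y) = Δ(v₂(−1,·))(y′)`. -/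
theorem laplacian_two_eq_of_hotPoints (hrate : HasTypeITimeDecay C v)
    (hcont : ContinuousOn (uncurry v) (Iio (0 : ℝ) ×ˢ univ))
    (hmild : ∀ s t : ℝ, s < t → t < 0 → ∀ x, v t x = heatExtension (v s) (t - s) x - oseenDuhamel 1 s v v t x)
    (hdiv : ∀ t < 0, VectorCalculus.IsDivFree (v t))
    (hpol : ∀ s < 0, ∀ y, ⟪curl (v s) y, EuclideanSpace.single 2 1⟫_ℝ = 0)
    {μ : ℝ → ℝ → ℝ} (hμ : ContDiff ℝ 3 (uncurry μ))
    (hslope : ∀ y : EuclideanSpace ℝ (Fin 3), y 2 = 0 →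
      ∀ᶠ z in 𝓝 (((-1 : ℝ), y) : ℝ × EuclideanSpace ℝ (Fin 3)), ∀ b : Fin 3, b ≠ 2 →
        fderiv ℝ (v z.1) z.2 (EuclideanSpace.single 2 1) b = μ z.1 (z.2 2) * fderiv ℝ (v z.1) z.2 (EuclideanSpace.single b 1) 2)
    (hμ1 : μ (-1) 0 ≠ 1)
    (hne : v (-1) 0 2 ≠ 0) (hhot : ∀ t < 0, ∀ x, Real.sqrt (-t) * |v t x 2| ≤ |v (-1) 0 2|)
    {y y' : EuclideanSpace ℝ (Fin 3)} (hy0 : y 2 = 0) (hy'0 : y' 2 = 0) (hy : v (-1) y 2 = v (-1) 0 2) (hy' : v (-1) y' 2 = v (-1) 0 2) :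
    (Δ (fun w => v (-1) w 2)) y = (Δ (fun w => v (-1) w 2)) y' := by
  have hs : (-1 : ℝ) < 0 := by norm_num
  have hyy' : y 2 = y' 2 := by rw [hy0, hy'0]
  have hS := weightSource_eq_of_height_eq hrate hcont hmild hdiv hpol hμ hs hyy' (fun w hw => hslope w (by rw [← hy0]; exact hw))
  rw [residual_two_of_hotPoint hrate hcont hmild hdiv hne hhot hy, residual_two_of_hotPoint hrate hcont hmild hdiv hne hhot hy',
    gradPin_of_hotPoint hrate hcont hmild hdiv hhot hy, gradPin_of_hotPoint hrate hcont hmild hdiv hhot hy', hy, hy', hy0, hy'0] at hS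
  -- `hS : 2(1−μ₀)(N/2 − L) − c = 2(1−μ₀)(N/2 − L′) − c`
  have hρ : (1 - μ (-1) 0) ≠ 0 := sub_ne_zero.2 (Ne.symm hμ1)
  have h2 : 2 * (1 - μ (-1) 0) * ((Δ (fun w => v (-1) w 2)) y - (Δ (fun w => v (-1) w 2)) y') = 0 := by linarith
  have h3 : (Δ (fun w => v (-1) w 2)) y - (Δ (fun w => v (-1) w 2)) y' = 0 := by
    rcases mul_eq_zero.1 h2 with h | h
    · exact absurd h (mul_ne_zero two_ne_zero hρ)
    · exact h
  linarith

/-- **THE RIDGE LAW, vertical pressure gradient.**  Under the same hypotheses, for every classical pressure `P` of the profile on `t < 0`: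
`(∇P(−1,·))(y)₂ = (∇P(−1,·))(y′)₂` at any two hot points of the thread plane. -/
theorem gradient_pressure_two_eq_of_hotPoints (hrate : HasTypeITimeDecay C v)
    (hcont : ContinuousOn (uncurry v) (Iio (0 : ℝ) ×ˢ univ))
    (hmild : ∀ s t : ℝ, s < t → t < 0 → ∀ x, v t x = heatExtension (v s) (t - s) x - oseenDuhamel 1 s v v t x)
    (hdiv : ∀ t < 0, VectorCalculus.IsDivFree (v t))
    (hpol : ∀ s < 0, ∀ y, ⟪curl (v s) y, EuclideanSpace.single 2 1⟫_ℝ = 0)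
    {μ : ℝ → ℝ → ℝ} (hμ : ContDiff ℝ 3 (uncurry μ))
    (hslope : ∀ y : EuclideanSpace ℝ (Fin 3), y 2 = 0 →
      ∀ᶠ z in 𝓝 (((-1 : ℝ), y) : ℝ × EuclideanSpace ℝ (Fin 3)), ∀ b : Fin 3, b ≠ 2 →
        fderiv ℝ (v z.1) z.2 (EuclideanSpace.single 2 1) b = μ z.1 (z.2 2) * fderiv ℝ (v z.1) z.2 (EuclideanSpace.single b 1) 2)
    (hμ1 : μ (-1) 0 ≠ 1)
    (hne : v (-1) 0 2 ≠ 0) (hhot : ∀ t < 0, ∀ x, Real.sqrt (-t) * |v t x 2| ≤ |v (-1) 0 2|)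
    {P : ℝ → EuclideanSpace ℝ (Fin 3) → ℝ} (hP : IsClassicalNSSolutionOn (Iio 0) 1 0 v P)
    {y y' : EuclideanSpace ℝ (Fin 3)} (hy0 : y 2 = 0) (hy'0 : y' 2 = 0) (hy : v (-1) y 2 = v (-1) 0 2) (hy' : v (-1) y' 2 = v (-1) 0 2) :
    gradient (P (-1)) y 2 = gradient (P (-1)) y' 2 := by
  rw [gradient_pressure_two_of_hotPoint hrate hcont hmild hdiv hne hhot hy hP, gradient_pressure_two_of_hotPoint hrate hcont hmild hdiv hne hhot hy' hP,
    laplacian_two_eq_of_hotPoints hrate hcont hmild hdiv hpol hμ hslope hμ1 hne hhot hy0 hy'0 hy hy']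

/-- The Laplacian of `v₂(−1,·)` splits into the horizontal part and `∂₂²`. -/
theorem laplacian_two_split (hrate : HasTypeITimeDecay C v)
    (hcont : ContinuousOn (uncurry v) (Iio (0 : ℝ) ×ˢ univ))
    (hmild : ∀ s t : ℝ, s < t → t < 0 → ∀ x, v t x = heatExtension (v s) (t - s) x - oseenDuhamel 1 s v v t x)
    (hdiv : ∀ t < 0, VectorCalculus.IsDivFree (v t)) (y : EuclideanSpace ℝ (Fin 3)) :
    (Δ (fun w => v (-1) w 2)) y =
      (fderiv ℝ (fun w => fderiv ℝ (fun y' => v (-1) y' 2) w (EuclideanSpace.single 0 (1 : ℝ))) y (EuclideanSpace.single 0 (1 : ℝ)) +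
        fderiv ℝ (fun w => fderiv ℝ (fun y' => v (-1) y' 2) w (EuclideanSpace.single 1 (1 : ℝ))) y (EuclideanSpace.single 1 (1 : ℝ))) +
      fderiv ℝ (fun w => fderiv ℝ (fun y' => v (-1) y' 2) w (EuclideanSpace.single 2 (1 : ℝ))) y (EuclideanSpace.single 2 (1 : ℝ)) := by
  have hs : (-1 : ℝ) < 0 := by norm_num
  have hθ : ContDiff ℝ 2 (fun w : EuclideanSpace ℝ (Fin 3) => v (-1) w 2) :=
    (PoloidalWindowDoorPoloidalWindowRigiditySlopeFunctionPressure.contDiff_vert_slice hrate hcont hmild hdiv hs).of_le (by norm_cast)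
  have hΔ := congrFun (InnerProductSpace.laplacian_eq_iteratedFDeriv_orthonormalBasis (fun w : EuclideanSpace ℝ (Fin 3) => v (-1) w 2)
    (EuclideanSpace.basisFun (Fin 3) ℝ)) y
  simp only [EuclideanSpace.basisFun_apply] at hΔ
  rw [hΔ, Fin.sum_univ_three]
  have e : ∀ i : Fin 3, iteratedFDeriv ℝ 2 (fun w : EuclideanSpace ℝ (Fin 3) => v (-1) w 2) y ![EuclideanSpace.single i (1 : ℝ), EuclideanSpace.single i (1 : ℝ)] =
      fderiv ℝ (fun w => fderiv ℝ (fun y' => v (-1) y' 2) w (EuclideanSpace.single i (1 : ℝ))) y (EuclideanSpace.single i (1 : ℝ)) := by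
    intro i
    rw [iteratedFDeriv_two_apply]
    simp only [Matrix.cons_val_zero, Matrix.cons_val_one]
    have hd : Differentiable ℝ (fderiv ℝ (fun y' : EuclideanSpace ℝ (Fin 3) => v (-1) y' 2)) :=
      (hθ.fderiv_right (m := 1) (by norm_cast)).differentiable (by simp)
    rw [fderiv_clm_apply (hd y) (differentiableAt_const _)]
    simp
  rw [e 0, e 1, e 2]

/-- **THE RIDGE LAW, horizontal Laplacian.**  Under the same hypotheses (with the (TH) identity AT the points of the thread plane with slope `μ(−1,0)`), the horizontal
Laplacian `∂₀²v₂ + ∂₁²v₂` of the slice `−1` takes the same value at any two hot points of `P₀` (the transversal curvature of the ridge is constant along it). -/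
theorem horizLaplacian_two_eq_of_hotPoints (hrate : HasTypeITimeDecay C v)
    (hcont : ContinuousOn (uncurry v) (Iio (0 : ℝ) ×ˢ univ))
    (hmild : ∀ s t : ℝ, s < t → t < 0 → ∀ x, v t x = heatExtension (v s) (t - s) x - oseenDuhamel 1 s v v t x)
    (hdiv : ∀ t < 0, VectorCalculus.IsDivFree (v t))
    (hpol : ∀ s < 0, ∀ y, ⟪curl (v s) y, EuclideanSpace.single 2 1⟫_ℝ = 0)
    {μ : ℝ → ℝ → ℝ} (hμ : ContDiff ℝ 3 (uncurry μ))
    (hslope : ∀ y : EuclideanSpace ℝ (Fin 3), y 2 = 0 →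
      ∀ᶠ z in 𝓝 (((-1 : ℝ), y) : ℝ × EuclideanSpace ℝ (Fin 3)), ∀ b : Fin 3, b ≠ 2 →
        fderiv ℝ (v z.1) z.2 (EuclideanSpace.single 2 1) b = μ z.1 (z.2 2) * fderiv ℝ (v z.1) z.2 (EuclideanSpace.single b 1) 2)
    (hμ1 : μ (-1) 0 ≠ 1)
    (hne : v (-1) 0 2 ≠ 0) (hhot : ∀ t < 0, ∀ x, Real.sqrt (-t) * |v t x 2| ≤ |v (-1) 0 2|)
    {y y' : EuclideanSpace ℝ (Fin 3)} (hy0 : y 2 = 0) (hy'0 : y' 2 = 0) (hy : v (-1) y 2 = v (-1) 0 2) (hy' : v (-1) y' 2 = v (-1) 0 2) :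
    fderiv ℝ (fun w => fderiv ℝ (fun y' => v (-1) y' 2) w (EuclideanSpace.single 0 (1 : ℝ))) y (EuclideanSpace.single 0 (1 : ℝ)) +
        fderiv ℝ (fun w => fderiv ℝ (fun y' => v (-1) y' 2) w (EuclideanSpace.single 1 (1 : ℝ))) y (EuclideanSpace.single 1 (1 : ℝ)) =
      fderiv ℝ (fun w => fderiv ℝ (fun y' => v (-1) y' 2) w (EuclideanSpace.single 0 (1 : ℝ))) y' (EuclideanSpace.single 0 (1 : ℝ)) +
        fderiv ℝ (fun w => fderiv ℝ (fun y' => v (-1) y' 2) w (EuclideanSpace.single 1 (1 : ℝ))) y' (EuclideanSpace.single 1 (1 : ℝ)) := by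
  have hs : (-1 : ℝ) < 0 := by norm_num
  have hL := laplacian_two_eq_of_hotPoints hrate hcont hmild hdiv hpol hμ hslope hμ1 hne hhot hy0 hy'0 hy hy'
  -- the slope on the plane `P₀` itself
  have hslope0 : ∀ w : EuclideanSpace ℝ (Fin 3), w 2 = 0 → ∀ b : Fin 3, b ≠ 2 →
      fderiv ℝ (v (-1)) w (EuclideanSpace.single 2 (1 : ℝ)) b = μ (-1) 0 * fderiv ℝ (v (-1)) w (EuclideanSpace.single b (1 : ℝ)) 2 := by
    intro w hw b hb
    have h := (hslope w hw).self_of_nhds b hb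
    rw [hw] at h
    exact h
  have hu : ContDiff ℝ 2 (v (-1)) := (PoloidalWindowDoorPoloidalWindowRigidityClebsch.contDiff_slice hrate hcont hmild hs).of_le (by norm_cast)
  have hw := fun (x : EuclideanSpace ℝ (Fin 3)) (hx : x 2 = 0) => plane_wave_identity hu (fun x => div_coord (hdiv (-1) hs) x) hslope0 hx
  rw [laplacian_two_split hrate hcont hmild hdiv y, laplacian_two_split hrate hcont hmild hdiv y', hw y hy0, hw y' hy'0] at hL
  -- `(1 − μ₀)·(Δₕ(y) − Δₕ(y′)) = 0`
  have hρ : (1 - μ (-1) 0) ≠ 0 := sub_ne_zero.2 (Ne.symm hμ1)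
  set A := fderiv ℝ (fun w => fderiv ℝ (fun y' => v (-1) y' 2) w (EuclideanSpace.single 0 (1 : ℝ))) y (EuclideanSpace.single 0 (1 : ℝ)) +
        fderiv ℝ (fun w => fderiv ℝ (fun y' => v (-1) y' 2) w (EuclideanSpace.single 1 (1 : ℝ))) y (EuclideanSpace.single 1 (1 : ℝ)) with hA
  set B := fderiv ℝ (fun w => fderiv ℝ (fun y' => v (-1) y' 2) w (EuclideanSpace.single 0 (1 : ℝ))) y' (EuclideanSpace.single 0 (1 : ℝ)) +
        fderiv ℝ (fun w => fderiv ℝ (fun y' => v (-1) y' 2) w (EuclideanSpace.single 1 (1 : ℝ))) y' (EuclideanSpace.single 1 (1 : ℝ)) with hB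
  have h2 : (1 - μ (-1) 0) * (A - B) = 0 := by linarith
  rcases mul_eq_zero.1 h2 with h | h
  · exact absurd h hρ
  · linarith

end Summit.NavierStokesRegularity.NavierStokesRegularity.Theorems.PoloidalWindowDoorLrcModEntireTwistingTHRidgeLaw
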